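import Literature.AlgebraicGeometry.GroupSchemes.GeneralLinearGroupActionProjectiveSpace
import Literature.AlgebraicGeometry.Motives.VarietiesProjectiveSpaceProofs
import Literature.AlgebraicGeometry.FundamentalGroup.HyperplanePencil
import Mathlib.LinearAlgebra.Matrix.Permutation
import HarnessLib

/-!
# Permutations of the coordinates `x₁, …, xₙ` act on `ℙⁿ_A` over `A`, preserving the chart `D₊(x₀)`

Topic `Literature/AlgebraicGeometry/GroupSchemes`, namespace `Literature.AlgebraicGeometry.GroupSchemes.ProjLinAction`
(continues `GroupSchemes/GeneralLinearGroupActionProjectiveSpace`: `linSubst`, `projLinAut`, `projLinAction`).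
THEOREMS ONLY (no definition, no named fact, no notation; the `attribute [local instance]` lines are those of
`Motives/VarietiesProjectiveSpaceProofs`, needed to speak about `Proj A[x₀, …, xₙ]` and its chart algebra
`(A[x]_{x₀})₀` as an `A`-algebra).

R. Hartshorne, *Algebraic Geometry* II Example 7.1.1 (p. 151): an invertible matrix acts on `𝐏ⁿ` through the
induced automorphism of the polynomial ring; Görtz–Wedhorn I (11.15.1): `GL_{n+1} → Aut(ℙⁿ)` is a homomorphism.
For a PERMUTATION MATRIX the substitution is a renaming of the variables (`linSubst_permMatrix_X`,
`linSubst_permMatrix_apply`), and a permutation of `x₁, …, xₙ` FIXING `x₀` preserves the standard chart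
`D₊(x₀) ≅ 𝔸ⁿ_A`, acting there by renaming the affine coordinates `yⱼ = xⱼ/x₀`:

* `exists_permAction_proj` — there is `ρ : 𝔖ₙ →* Aut (Proj A[x₀, …, xₙ])` (`projLinAction` of the permutation
  matrices `Matrix.permMatrixHom`, the permutation extended by `x₀ ↦ x₀` through `Equiv.Perm.extendDomainHom`)
  with every `ρ σ` over `Spec A[x]₀` and
  `D₊(x₀).ι ≫ ρ σ = Spec (chart⁻¹ ∘ rename σ⁻¹ ∘ chart) ≫ D₊(x₀).ι`, `chart = Motives.ProjectiveSpace.chartAlgEquiv A 0`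
  (Mathlib `Proj.awayι_comp_map`, transported along `σ̃(x₀) = x₀`).

Use (route `HodgeConjecture/Q8SymplecticPowers`, crux K1Q stmt-HodgeConjecture-24190, brick «B3» of the Kollár-free
deck family; route-agnostic): together with `GroupActions/EquivariantPolynomialPresentation` it gives an
EQUIVARIANT immersion of an affine scheme of finite type with a finite group action into `ℙⁿ`, the group acting
on `ℙⁿ` linearly (`Resolution/EquivariantProjectiveEmbedding`). Nothing here bears on HC.

## References

* [Hartshorne1977] R. Hartshorne, Algebraic Geometry (1977), II Example 7.1.1 (p. 151), II Prop. 2.5 (b).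
* [GortzWedhorn2020] U. Görtz, T. Wedhorn, Algebraic Geometry I, 2nd ed. (2020), (11.15.1), (13.2).
-/

noncomputable section

universe u

open CategoryTheory AlgebraicGeometry MvPolynomial HomogeneousLocalization

attribute [local instance] MvPolynomial.gradedAlgebra
  Literature.AlgebraicGeometry.Motives.ProjBaseChange.algebraBase
  Literature.AlgebraicGeometry.Motives.ProjBaseChange.isScalarTower_localization

namespace Literature.AlgebraicGeometry.GroupSchemes.ProjLinAction

open Literature.AlgebraicGeometry.Motives Literature.AlgebraicGeometry.FundamentalGroup

variable (A : Type u) [CommRing A] (n : ℕ)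

/-- The linear substitution by a permutation matrix is the renaming of the variables:
`linSubst A (P_τ) (xᵢ) = x_{τ i}`. [cite: Hartshorne1977, II Example 7.1.1 (p. 151)] -/
theorem linSubst_permMatrix_X {ι : Type} [Fintype ι] [DecidableEq ι] (τ : Equiv.Perm ι) (i : ι) :
    linSubst A (τ.permMatrix A) (X i) = X (τ i) := by
  rw [linSubst_X]
  have h : ∀ j : ι, monomial (Finsupp.single j 1) ((τ.permMatrix A) i j) =
      if j = τ i then (X (τ i) : MvPolynomial ι A) else 0 := by
    intro j
    by_cases hj : j = τ i
    · subst hj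
      rw [if_pos rfl, show (τ.permMatrix A) i (τ i) = 1 by simp [Equiv.toPEquiv_apply]]
      rfl
    · rw [if_neg hj, show (τ.permMatrix A) i j = 0 by simp [Equiv.toPEquiv_apply, Ne.symm hj], monomial_zero]
  simp_rw [h]
  rw [Finset.sum_ite_eq' Finset.univ (τ i) (fun _ => (X (τ i) : MvPolynomial ι A)), if_pos (Finset.mem_univ _)]

/-- Hence `linSubst A (P_τ) = rename τ` on every polynomial. [cite: Hartshorne1977, II Example 7.1.1 (p. 151)] -/
theorem linSubst_permMatrix_apply {ι : Type} [Fintype ι] [DecidableEq ι] (τ : Equiv.Perm ι)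
    (p : MvPolynomial ι A) : linSubst A (τ.permMatrix A) p = rename τ p := by
  have h : ((linSubst A (τ.permMatrix A) : _ →+*ᵍ _) : MvPolynomial ι A →+* MvPolynomial ι A) =
      (rename τ : MvPolynomial ι A →ₐ[A] MvPolynomial ι A).toRingHom := by
    refine MvPolynomial.ringHom_ext (fun a => ?_) (fun i => ?_)
    · change linSubst A (τ.permMatrix A) (C a) = rename τ (C a)
      rw [linSubst_C, rename_C]
    · change linSubst A (τ.permMatrix A) (X i) = rename τ (X i)
      rw [linSubst_permMatrix_X, rename_X]
  exact congrFun (congrArg DFunLike.coe h) p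

/-- Transport of a chart of `Proj` along an equality `s = s'` of the inverted element (the tree's
`FundamentalGroup.HyperplanePencil.specMap_awayCongr_comp_awayι`, restated here to keep the imports light).
[folklore] -/
private theorem specMap_awayCongr_comp_awayι' {B τ : Type u} [CommRing B] [SetLike τ B] [AddSubgroupClass τ B]
    (ℬ : ℕ → τ) [GradedRing ℬ] {s s' : B} (h : s = s') {d : ℕ} (hs : s ∈ ℬ d) (hd : 0 < d) :
    Spec.map (CommRingCat.ofHom (awayCongr ℬ h)) ≫ Proj.awayι ℬ s hs hd = Proj.awayι ℬ s' (h ▸ hs) hd := by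
  subst h
  have : (awayCongr ℬ (rfl : s = s) : Away ℬ s →+* Away ℬ s) = RingHom.id _ := by
    change HomogeneousLocalization.map (GradedRingHom.id ℬ) _ = _
    rw [HomogeneousLocalization.map_id]
  rw [this, CommRingCat.ofHom_id, Spec.map_id, Category.id_comp]

/-- **Permutations of `x₁, …, xₙ` act on `ℙⁿ_A = Proj A[x₀, …, xₙ]` over `A`, preserving the standard chart
`D₊(x₀)`, on which they act by renaming the affine coordinates.** There is a homomorphism
`ρ : 𝔖ₙ → Aut(ℙⁿ_A)` (the permutation matrices of `GroupSchemes.ProjLinAction.projLinAction`, extended by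
`x₀ ↦ x₀`) such that every `ρ σ` commutes with the structure map to `Spec A[x]₀` and restricts to the chart
`D₊(x₀) = Spec (A[x]_{x₀})₀` as `Spec` of the `A`-algebra automorphism which, in the affine coordinates
`yⱼ = xⱼ/x₀` (`Motives.ProjectiveSpace.chartAlgEquiv`), is `rename σ⁻¹`. [cite: Hartshorne1977, II Example 7.1.1 (p. 151)]
[cite: GortzWedhorn2020, (11.15.1)] -/
theorem exists_permAction_proj :
    ∃ ρ : Equiv.Perm (Fin n) →* Aut (Proj (homogeneousSubmodule (Fin (n + 1)) A)),
      (∀ σ, (ρ σ).hom ≫ Proj.toSpecZero (homogeneousSubmodule (Fin (n + 1)) A) =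
        Proj.toSpecZero (homogeneousSubmodule (Fin (n + 1)) A)) ∧
      ∀ σ, Proj.awayι (homogeneousSubmodule (Fin (n + 1)) A) (X 0) (ProjectiveSpace.X_mem 0) zero_lt_one ≫
          (ρ σ).hom =
        Spec.map (CommRingCat.ofHom (((ProjectiveSpace.chartAlgEquiv A (0 : Fin (n + 1))).symm.toAlgHom.comp
          ((rename ⇑σ⁻¹).comp (ProjectiveSpace.chartAlgEquiv A (0 : Fin (n + 1))).toAlgHom)).toRingHom)) ≫
          Proj.awayι (homogeneousSubmodule (Fin (n + 1)) A) (X 0) (ProjectiveSpace.X_mem 0) zero_lt_one := by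
  classical
  -- `σ ↦ σ̃` (fix `x₀`), `↦` its permutation matrix in `GL_{n+1}(A)`, `↦ projLinAut`
  let ext : Equiv.Perm (Fin n) →* Equiv.Perm (Fin (n + 1)) := Equiv.Perm.extendDomainHom (finSuccAboveEquiv 0)
  let M : Equiv.Perm (Fin (n + 1)) →* GL (Fin (n + 1)) A :=
    (Matrix.permMatrixHom (n := Fin (n + 1)) (R := A)).toHomUnits
  let ρ : Equiv.Perm (Fin n) →* Aut (Proj (homogeneousSubmodule (Fin (n + 1)) A)) := ((projLinAction A (Fin (n + 1))).comp M).comp ext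
  have hext0 : ∀ σ : Equiv.Perm (Fin n), ext σ 0 = 0 := fun σ =>
    Equiv.Perm.extendDomain_apply_not_subtype _ _ (by simp)
  have hextS : ∀ (σ : Equiv.Perm (Fin n)) (j : Fin n), ext σ j.succ = (σ j).succ := fun σ j => by
    change σ.extendDomain (finSuccAboveEquiv 0) j.succ = (σ j).succ
    have h := Equiv.Perm.extendDomain_apply_image σ (finSuccAboveEquiv (0 : Fin (n + 1))) j
    simpa [finSuccAboveEquiv_apply, Fin.succAbove_zero] using h
  have hM : ∀ τ : Equiv.Perm (Fin (n + 1)), ((M τ : GL (Fin (n + 1)) A) : Matrix (Fin (n + 1)) (Fin (n + 1)) A) = τ⁻¹.permMatrix A :=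
    fun τ => rfl
  have hρ : ∀ σ, (ρ σ).hom = Proj.map (linSubst A ((M (ext σ) : GL (Fin (n + 1)) A) : Matrix (Fin (n + 1)) (Fin (n + 1)) A))
      (irrelevant_le_map_linSubst (M (ext σ))) := fun σ => by
    change ((projLinAction A (Fin (n + 1))) (M (ext σ))).hom = _
    rw [projLinAction_apply, projLinAut_hom]
  -- the substitution of `ρ σ` is `rename (ext σ)⁻¹`; it fixes `x₀` and sends `x_{j+1}` to `x_{σ⁻¹ j + 1}`
  have hF : ∀ (σ : Equiv.Perm (Fin n)) (p : MvPolynomial (Fin (n + 1)) A),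
      linSubst A ((M (ext σ) : GL (Fin (n + 1)) A) : Matrix (Fin (n + 1)) (Fin (n + 1)) A) p = rename ⇑(ext σ⁻¹) p := by
    intro σ p
    rw [hM, ← map_inv, linSubst_permMatrix_apply]
  have hF0 : ∀ σ : Equiv.Perm (Fin n),
      linSubst A ((M (ext σ) : GL (Fin (n + 1)) A) : Matrix (Fin (n + 1)) (Fin (n + 1)) A) (X 0) = X 0 := fun σ => by
    rw [hF, rename_X, hext0]
  have hFS : ∀ (σ : Equiv.Perm (Fin n)) (j : Fin n),
      linSubst A ((M (ext σ) : GL (Fin (n + 1)) A) : Matrix (Fin (n + 1)) (Fin (n + 1)) A) (X j.succ) = X (σ⁻¹ j).succ := fun σ j => by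
    rw [hF, rename_X, hextS]
  refine ⟨ρ, fun σ => ?_, fun σ => ?_⟩
  · rw [hρ, map_comp_toSpecZero, degreeZero_linSubst]
    change _ ≫ Spec.map (𝟙 _) = _
    rw [Spec.map_id, Category.comp_id]
  · -- the chart `D₊(x₀)`
    rw [hρ]
    set F := linSubst A ((M (ext σ) : GL (Fin (n + 1)) A) : Matrix (Fin (n + 1)) (Fin (n + 1)) A) with hFdef
    have hmem : F (X 0) ∈ (homogeneousSubmodule (Fin (n + 1)) A) 1 := F.2 (ProjectiveSpace.X_mem 0)
    -- `awayι (x₀) = Spec (awayCongr) ≫ awayι (F x₀)` and Mathlib's `awayι_comp_map`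
    have e1 : Proj.awayι (homogeneousSubmodule (Fin (n + 1)) A) (X 0) (ProjectiveSpace.X_mem 0) zero_lt_one =
        Spec.map (CommRingCat.ofHom (awayCongr (homogeneousSubmodule (Fin (n + 1)) A) (hF0 σ))) ≫
          Proj.awayι (homogeneousSubmodule (Fin (n + 1)) A) (F (X 0)) hmem zero_lt_one :=
      (specMap_awayCongr_comp_awayι' (homogeneousSubmodule (Fin (n + 1)) A) (hF0 σ) hmem zero_lt_one).symm
    have e2 := Proj.awayι_comp_map F (irrelevant_le_map_linSubst (M (ext σ))) zero_lt_one (X 0)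
      (ProjectiveSpace.X_mem 0)
    have step : Proj.awayι (homogeneousSubmodule (Fin (n + 1)) A) (X 0) (ProjectiveSpace.X_mem 0) zero_lt_one ≫
        Proj.map F (irrelevant_le_map_linSubst (M (ext σ))) =
        Spec.map (CommRingCat.ofHom ((awayCongr (homogeneousSubmodule (Fin (n + 1)) A) (hF0 σ)).comp
          (Away.map F (X 0)))) ≫
          Proj.awayι (homogeneousSubmodule (Fin (n + 1)) A) (X 0) (ProjectiveSpace.X_mem 0) zero_lt_one := by
      rw [CommRingCat.ofHom_comp, Spec.map_comp_assoc, ← e2, ← Category.assoc, ← e1]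
    -- the chart ring map is `rename σ⁻¹` in the affine coordinates
    have hT : (awayCongr (homogeneousSubmodule (Fin (n + 1)) A) (hF0 σ)).comp (Away.map F (X 0)) =
        ((ProjectiveSpace.chartAlgEquiv A (0 : Fin (n + 1))).symm.toAlgHom.comp
          ((rename ⇑σ⁻¹).comp (ProjectiveSpace.chartAlgEquiv A (0 : Fin (n + 1))).toAlgHom)).toRingHom := by
      rw [← RingHom.cancel_right (ProjectiveSpace.chartAlgEquiv A (0 : Fin (n + 1))).symm.surjective]
      have hFC : ∀ a : A, F (C a) = C a := fun a => linSubst_C _ a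
      refine MvPolynomial.ringHom_ext (fun a => ?_) (fun j => ?_)
      · have hC : (ProjectiveSpace.chartAlgEquiv A (0 : Fin (n + 1))).symm (C a) =
            algebraMap A (Away (homogeneousSubmodule (Fin (n + 1)) A) (X 0)) a := by
          rw [← MvPolynomial.algebraMap_eq]
          exact (ProjectiveSpace.chartAlgEquiv A (0 : Fin (n + 1))).symm.commutes a
        have hCa : (C a : MvPolynomial (Fin (n + 1)) A) ∈ (homogeneousSubmodule (Fin (n + 1)) A) (0 • 1) := by
          simp
        have halg : algebraMap A (Away (homogeneousSubmodule (Fin (n + 1)) A) (X 0)) a =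
            Away.mk (homogeneousSubmodule (Fin (n + 1)) A) (ProjectiveSpace.X_mem 0) 0 (C a) hCa := by
          apply HomogeneousLocalization.val_injective
          rw [ProjBaseChange.val_algebraMap, Away.val_mk,
            IsScalarTower.algebraMap_apply A (MvPolynomial (Fin (n + 1)) A) (Localization.Away (X 0 : MvPolynomial (Fin (n + 1)) A)),
            MvPolynomial.algebraMap_eq, ← Localization.mk_one_eq_algebraMap]
          congr 1
        change awayCongr _ (hF0 σ) (Away.map F (X 0) ((ProjectiveSpace.chartAlgEquiv A (0 : Fin (n + 1))).symm (C a))) =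
          (ProjectiveSpace.chartAlgEquiv A (0 : Fin (n + 1))).symm (rename ⇑σ⁻¹
            (ProjectiveSpace.chartAlgEquiv A (0 : Fin (n + 1)) ((ProjectiveSpace.chartAlgEquiv A (0 : Fin (n + 1))).symm (C a))))
        rw [AlgEquiv.apply_symm_apply, rename_C, hC, halg, Away.map_mk]
        apply HomogeneousLocalization.val_injective
        rw [val_awayCongr_mk, Away.val_mk]
        simp_rw [hFC]
      · have hFj : F (X (Fin.succAbove 0 j)) = X (Fin.succAbove 0 (σ⁻¹ j)) := by
          rw [Fin.succAbove_zero]; exact hFS σ j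
        change awayCongr _ (hF0 σ) (Away.map F (X 0) ((ProjectiveSpace.chartAlgEquiv A (0 : Fin (n + 1))).symm (X j))) =
          (ProjectiveSpace.chartAlgEquiv A (0 : Fin (n + 1))).symm (rename ⇑σ⁻¹
            (ProjectiveSpace.chartAlgEquiv A (0 : Fin (n + 1)) ((ProjectiveSpace.chartAlgEquiv A (0 : Fin (n + 1))).symm (X j))))
        rw [AlgEquiv.apply_symm_apply, rename_X, ProjectiveSpace.chartAlgEquiv_symm_X,
          ProjectiveSpace.chartAlgEquiv_symm_X]
        simp only [ProjectiveSpace.chartGen]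
        rw [Away.map_mk]
        apply HomogeneousLocalization.val_injective
        rw [val_awayCongr_mk, Away.val_mk]
        simp_rw [hFj]
    rw [step, hT]

end Literature.AlgebraicGeometry.GroupSchemes.ProjLinAction

end
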